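import Summits.AtomisticToContinuum.Crystallization.Theses.ChessboardParticlePlanes
import Summits.AtomisticToContinuum.Crystallization.Theorems.ChessboardParticlePlanesLjPlaneChessboardPlanarPeriods
import Mathlib.LinearAlgebra.FreeModule.PID

/-!
# Crux `ChessboardParticlePlanes.LjPlaneChessboard` (stmt-AtomisticToContinuum-6709), line `Sketch`,
# stub `stub_horizontalBasis` — a `ℤ`-basis of the horizontal periods

If the heights `g 2` of the periods `g ∈ G` of a periodic configuration `Q` of `ℝ³` lie in a
cyclic group `c₀ℤ` (and some period has height `c₀ > 0`), then the horizontal periods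
`Λ₀ = G ∩ {x₂ = 0}` form `ℤa ⊕ ℤb` for two `ℝ`-linearly independent horizontal periods `a, b`.
[folklore]

PROOF.  `Λ₀` is the kernel `K` of the `ℤ`-linear height map `G → ℝ`, `g ↦ g 2`.  `G` is free of
rank `3` (`PeriodicConfiguration.finrank_lattice`), so by the Smith normal form over the PID `ℤ`
(`Submodule.smithNormalForm`) there are a `ℤ`-basis `bM` of `G` indexed by `Fin 3`, a `ℤ`-basis
`bN` of `K` indexed by `Fin n`, an injection `f : Fin n ↪ Fin 3` and integers `aᵢ` with
`bN i = aᵢ • bM (f i)`; the `aᵢ` are nonzero.  Every element of `K` is an integer, hence real,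
combination of the `n` vectors `bN i`; since `K` contains the two `ℝ`-independent horizontal
periods of `stub_planarPeriods`, `n ≥ 2`, and if `n = 2` the two vectors `bN 0, bN 1` span a plane,
so they are `ℝ`-independent.  Finally `n ≠ 3`: otherwise `f` is onto, every `bM j` has a nonzero
multiple in `K`, so every `bM j` is horizontal and the height map vanishes on `G`, contradicting
the period of height `c₀ > 0`.  Hence `n = 2` and `a := bN 0`, `b := bN 1` do.
-/

noncomputable section

namespace Summit.AtomisticToContinuum.Crystallization.Theorems.ChessboardParticlePlanesLjPlaneChessboard

open Literature.MathematicalPhysics.StatisticalMechanics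

/-- Linear algebra: if two `ℝ`-linearly independent vectors lie in the span of a family
`w : Fin n → E`, then `2 ≤ n`, and if moreover `n = 2` then `w` is linearly independent
(the span of `w` has dimension between `2` and `n`). [folklore] -/
theorem horizontalBasis_two_le {E : Type*} [AddCommGroup E] [Module ℝ E] {n : ℕ}
    {w : Fin n → E} {u v : E} (huv : LinearIndependent ℝ ![u, v])
    (hu : u ∈ Submodule.span ℝ (Set.range w)) (hv : v ∈ Submodule.span ℝ (Set.range w)) :
    2 ≤ n ∧ (n = 2 → LinearIndependent ℝ w) := by
  haveI := Module.Finite.span_of_finite ℝ (Set.finite_range w)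
  have h2 : Fintype.card (Fin 2) = Set.finrank ℝ (Set.range ![u, v]) :=
    linearIndependent_iff_card_eq_finrank_span.1 huv
  rw [Fintype.card_fin] at h2
  have hle : Submodule.span ℝ (Set.range ![u, v]) ≤ Submodule.span ℝ (Set.range w) := by
    rw [Submodule.span_le, Set.range_subset_iff]
    intro i
    fin_cases i
    exacts [hu, hv]
  have hmono : Set.finrank ℝ (Set.range ![u, v]) ≤ Set.finrank ℝ (Set.range w) :=
    Submodule.finrank_mono hle
  have hcard : Set.finrank ℝ (Set.range w) ≤ n := by
    have h := finrank_range_le_card (R := ℝ) w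
    rwa [Fintype.card_fin] at h
  refine ⟨by omega, fun hn => ?_⟩
  subst hn
  rw [linearIndependent_iff_card_eq_finrank_span, Fintype.card_fin]
  omega

/-- **Stub 13 — horizontal basis of the periods.**  If the heights `g 2` of the periods of a
periodic configuration `Q` of `ℝ³` lie in `c₀ℤ` (with a period of height `c₀ > 0`), then the
height-`0` periods form `ℤa ⊕ ℤb` for two `ℝ`-linearly-independent horizontal periods `a, b`:
Smith normal form of the kernel of the height map on a `ℤ`-basis of the period lattice, the rank
being pinned to `2` by `stub_planarPeriods` (at least two independent horizontal periods) and by the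
period of positive height (not every period is horizontal). [folklore] -/
theorem stub_horizontalBasis :
    ∀ Q : PeriodicConfiguration 3,
      (∃ c₀ : ℝ, 0 < c₀ ∧ (∃ g ∈ Q.lattice, g 2 = c₀) ∧ ∀ g ∈ Q.lattice, ∃ k : ℤ, g 2 = c₀ * k) →
      ∃ a ∈ Q.lattice, ∃ b ∈ Q.lattice, a 2 = 0 ∧ b 2 = 0 ∧ LinearIndependent ℝ ![a, b] ∧
        ∀ g ∈ Q.lattice, g 2 = 0 → ∃ k l : ℤ, g = (k : ℝ) • a + (l : ℝ) • b := by
  classical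
  rintro Q ⟨c₀, hc₀, ⟨g₀, hg₀, hg₀c⟩, hmul⟩
  -- two `ℝ`-independent horizontal periods
  obtain ⟨u, hu, v, hv, hu0, hv0, huv⟩ := stub_planarPeriods Q ⟨c₀, hc₀, ⟨g₀, hg₀, hg₀c⟩, hmul⟩
  -- the height map and its kernel, the horizontal periods
  let ht : Q.lattice →ₗ[ℤ] ℝ :=
    { toFun := fun g => (g : EuclideanSpace ℝ (Fin 3)) 2
      map_add' := fun x y => by simp
      map_smul' := fun m x => by simp }
  let K : Submodule ℤ Q.lattice := LinearMap.ker ht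
  have hmemK : ∀ {g} (hg : g ∈ Q.lattice), g 2 = 0 → (⟨g, hg⟩ : Q.lattice) ∈ K :=
    fun hg h => LinearMap.mem_ker.2 h
  -- Smith normal form of `K` with respect to a `ℤ`-basis of the lattice of periods
  obtain ⟨n, bM, bN, f, a, hsnf⟩ :=
    Submodule.smithNormalForm (Module.finBasisOfFinrankEq ℤ Q.lattice Q.finrank_lattice) K
  -- every horizontal period is an integer combination of the `bN i`
  have hrepr : ∀ x : K, ((x : Q.lattice) : EuclideanSpace ℝ (Fin 3)) =
      ∑ i, (bN.repr x i) • ((bN i : Q.lattice) : EuclideanSpace ℝ (Fin 3)) := by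
    intro x
    conv_lhs => rw [← bN.sum_repr x]
    simp only [Submodule.coe_sum, SetLike.val_smul]
  have hspan : ∀ x : K, ((x : Q.lattice) : EuclideanSpace ℝ (Fin 3)) ∈
      Submodule.span ℝ (Set.range fun i => ((bN i : Q.lattice) : EuclideanSpace ℝ (Fin 3))) := by
    intro x
    rw [hrepr x]
    exact Submodule.sum_mem _ fun i _ => zsmul_mem (Submodule.subset_span (Set.mem_range_self i)) _
  -- hence `2 ≤ n`
  have h2n := horizontalBasis_two_le huv (hspan ⟨⟨u, hu⟩, hmemK hu hu0⟩)
    (hspan ⟨⟨v, hv⟩, hmemK hv hv0⟩)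
  have hn3 : n ≤ 3 := by simpa using Fintype.card_le_of_embedding f
  -- the diagonal entries are nonzero
  have ha : ∀ i, a i ≠ 0 := by
    intro i hai
    have h := hsnf i
    rw [hai, zero_smul] at h
    exact bN.ne_zero i ((Submodule.coe_eq_zero).1 h)
  -- `n ≠ 3`: otherwise every period would be horizontal
  have hn3' : n ≠ 3 := by
    intro hn
    subst hn
    have hsurj : Function.Surjective f := Finite.surjective_of_injective f.injective
    have hzero : ht = 0 := by
      refine bM.ext fun j => ?_
      obtain ⟨i, rfl⟩ := hsurj j
      have hKi : ht (bN i : Q.lattice) = 0 := LinearMap.mem_ker.1 (bN i).2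
      rw [hsnf i, map_smul, smul_eq_zero] at hKi
      simpa using hKi.resolve_left (ha i)
    have h0 := LinearMap.congr_fun hzero ⟨g₀, hg₀⟩
    change g₀ 2 = 0 at h0
    linarith
  obtain rfl : n = 2 := by have := h2n.1; omega
  have hli := h2n.2 rfl
  refine ⟨((bN 0 : Q.lattice) : EuclideanSpace ℝ (Fin 3)), (bN 0 : Q.lattice).2,
    ((bN 1 : Q.lattice) : EuclideanSpace ℝ (Fin 3)), (bN 1 : Q.lattice).2,
    LinearMap.mem_ker.1 (bN 0).2, LinearMap.mem_ker.1 (bN 1).2, ?_, ?_⟩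
  · convert hli using 1
    ext i
    fin_cases i <;> rfl
  · intro g hg hg0
    have h := hrepr ⟨⟨g, hg⟩, hmemK hg hg0⟩
    rw [Fin.sum_univ_two] at h
    refine ⟨bN.repr ⟨⟨g, hg⟩, hmemK hg hg0⟩ 0, bN.repr ⟨⟨g, hg⟩, hmemK hg hg0⟩ 1, ?_⟩
    rw [Int.cast_smul_eq_zsmul, Int.cast_smul_eq_zsmul]
    exact h

end Summit.AtomisticToContinuum.Crystallization.Theorems.ChessboardParticlePlanesLjPlaneChessboard

end
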